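import Summits.BirchSwinnertonDyer.BirchSwinnertonDyer.Theorems.Rank1ResidualX9MuTransfer
import Summits.BirchSwinnertonDyer.BirchSwinnertonDyer.Theorems.Rank1ResidualX9CMPartner
import Literature.NumberTheory.EllipticCurves.Rank1Residual.X9SplitPrime
import HarnessLib

/-!
# Route `SmallImageMuTransfer` (rung K6, leaf `BSDpOnClassX9`), crux `AnalyticMuZeroX9`:
# the registered stub `stub_primes` — X9 lives at `p ∈ {5, 7}` — DISCHARGED MODULO the published
# split-Cartan classification, and the crux reduced to its two per-prime statements

HONEST FRAMING (cell `b2b-bsdres`, X9 prover lineage; verbatim): the cell deletes COMBINATION-SHAPED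
residual classes of the rank-≤1 BSD formula from PUBLISHED theorems only and TYPES the
construction-shaped remainder; this is not "finishing BSD".  Nothing below asserts anything about
any curve beyond what the kernel proves; class X9 stays TYPED at class level; no pair, count, mark or
tier word moves.

Helper file for the statement item `AnalyticMuZeroX9` (stmt-BirchSwinnertonDyer-19630) of the DRAFT
route `Theses/SmallImageMuTransfer.lean` (cell `bsd-smallim`).  Its registered BC3 skeleton
(sha af91c27a) reads `AnalyticMuZeroX9 ⇐ stub_primes + stub_five + stub_seven` with

  `stub_primes : ∀ W p, Rank1Residual.ClassX9 W p → p = 5 ∨ p = 7`.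

What the kernel can and cannot do with `stub_primes`, exactly:

* UNCONDITIONAL (Serre 1972, proved in the tree by this lineage, `Rank1Residual/X9ImageShape.lean`,
  `X9SplitPrime.lean`): at a good ORDINARY prime `p ≥ 7` with `E[p]` irreducible and `ρ̄_{E,p}`
  not onto, the image normalises a split Cartan subgroup `C` (type `pNs`), is not contained in it,
  and `ρ̄ ≅ Ind_M ψ̄` for the quadratic field `M` of `U = ρ̄⁻¹(C)`, with `p` SPLIT in `M` and `M`
  unramified at every good prime — `ClassX9.exists_index_two_subgroup_split_of_seven_le` below
  (Summits-side re-export over the route's predicate `Rank1Residual.ClassX9`).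
* PUBLISHED, NOT PROVABLE HERE: "no non-CM `E/ℚ` has mod-`p` image in the normaliser of a split
  Cartan subgroup for `p > 7`" = Bilu–Parent–Rebolledo 2013 Cor. 1.2 (`p ≥ 11`, `p ≠ 13`) +
  Balakrishnan–Dogra–Müller–Tuitman–Vonk 2019 Thm. 1.1 (`p = 13`, quadratic Chabauty), vendored as
  the named fact `BalakrishnanEtAl2019.thm12_not_le_normalizer_splitCartan` (no `_holds`).
  `stub_primes` is this fact restricted to good-ordinary irreducible pairs; so the stub is closed
  MODULO that one binder and nothing else: `ClassX9.eq_five_or_eq_seven_of_thm12` (the registered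
  signature, verbatim, as conclusion).  A kernel proof of the bare stub would be a kernel proof of
  (that case of) BPR + BDMTV.
* COMPOSITION: with the binder, the crux — the item's signature
  `Rank1Residual.AnalyticMuZeroOnClassX9`, of which the route decl
  `Theses.SmallImageMuTransfer.AnalyticMuZeroX9` is by definition a copy — follows from the two
  per-prime statements `stub_five`, `stub_seven` (verbatim the registered signatures):
  `analyticMuZeroX9_of_thm12`; i.e. the v2 skeleton shape that `ledger skeleton check` refuses to
  REGISTER (`skeleton.extra-hypothesis`) is a THEOREM here (referee bsd-smallim v8, road (ii)).  The
  route file is deliberately NOT imported (a DRAFT route's `Theses` module is re-rendered at every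
  edit); `unfold Theses.SmallImageMuTransfer.AnalyticMuZeroX9` + this theorem gives the route decl.

(X9 prover GEN 38, 2026-08-26; `--supports stmt-BirchSwinnertonDyer-19630 --as helper`.)
-/

-- the summit and its single problem are both named `BirchSwinnertonDyer` (registry layout D-0017)
set_option linter.dupNamespace false

set_option autoImplicit false

noncomputable section

open scoped Classical MatrixGroups ModularForm NumberField

open CongruenceSubgroup WeierstrassCurve Field IsDedekindDomain NumberField Matrix
open Literature.NumberTheory.EllipticCurves Literature.NumberTheory.EllipticCurves.ModularForms
open Literature.NumberTheory.GaloisRepresentations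
  Literature.NumberTheory.GaloisRepresentations.Serre1972

namespace Summit.BirchSwinnertonDyer.BirchSwinnertonDyer.Rank1Residual

/-! ### Unconditional: X9 at `p ≥ 7` is split-dihedral with `p` split in `M` -/

/-- **X9 at `p ≥ 7`, Summits-side (KERNEL, unconditional): `ρ̄_{E,p} ≅ Ind_M ψ̄` with `p` SPLIT in
`M`.**  For an X9 pair `(W, p)` (`Rank1Residual.ClassX9`: non-CM, `p ≥ 5` good ordinary, `E[p]`
irreducible, `ρ̄` not onto) with `7 ≤ p` and any frame `(e, Φ)` of `E[p]`: there is a split Cartan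
subgroup `C = P (* 0; 0 *) P⁻¹` with `G = Φ(ρ̄(Γ_ℚ)) ≤ N(C)`, `G ⊄ C` (image type `pNs`), the
subgroup `U = ρ̄⁻¹(Φ⁻¹(C))` is open of index `2`, contains the decomposition group of every prime
of `ℤ̄` above `p` (so `p` splits in the quadratic field `M` of `U`) and the inertia group above every
good prime (`M` is unramified outside the bad primes).  Serre 1972 §1.11 Cor. (inertia half-Cartan at
an ordinary prime), Prop. 14, Prop. 15, Prop. 17 (`p ≠ 5`), all proved in the tree
(`Rank1Residual.ClassX9.exists_index_two_subgroup_split`, X9 lineage gen 3–4), transported along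
`classX9_census_of_classX9`.  At `p = 5` Prop. 17 does not apply and the exceptional type `5S4`
occurs beside `5Ns`. [cite: Serre1972, §1.11 Cor. to Prop. 11; §2.2 Prop. 14; §2.7 Prop. 17] -/
theorem ClassX9.exists_index_two_subgroup_split_of_seven_le
    (W : WeierstrassCurve ℚ) [W.IsElliptic] [W.IsGloballyMinimal] (p : ℕ) [Fact p.Prime]
    (Φ : Multiplicative (AddAut (geomTorsion W p)) ≃* GL (Fin 2) (ZMod p))
    (e : geomTorsion W p ≃+ (Fin 2 → ZMod p))
    (he : ∀ (g : Multiplicative (AddAut (geomTorsion W p))) (x : geomTorsion W p),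
      e (Multiplicative.toAdd g x) =
        ((Φ g : GL (Fin 2) (ZMod p)) : Matrix (Fin 2) (Fin 2) (ZMod p)) *ᵥ e x)
    (h : ClassX9 W p) (h7 : 7 ≤ p) :
    ∃ (P : GL (Fin 2) (ZMod p)),
      (galoisRepTorsion W p).range.map Φ.toMonoidHom ≤
          Subgroup.normalizer (splitCartan P : Set (GL (Fin 2) (ZMod p))) ∧
      ¬ (galoisRepTorsion W p).range.map Φ.toMonoidHom ≤ splitCartan P ∧
      IsOpen ((((splitCartan P).comap Φ.toMonoidHom).comap (galoisRepTorsion W p) :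
          Subgroup (absoluteGaloisGroup ℚ)) : Set (absoluteGaloisGroup ℚ)) ∧
      (((splitCartan P).comap Φ.toMonoidHom).comap (galoisRepTorsion W p)).index = 2 ∧
      (∀ v : HeightOneSpectrum (𝓞 ℚ), (Rat.HeightOneSpectrum.primesEquiv v : ℕ) = p →
        ∀ 𝔓 ∈ v.primesAbove, 𝔓.decompositionSubgroup (absoluteGaloisGroup ℚ) ≤
          ((splitCartan P).comap Φ.toMonoidHom).comap (galoisRepTorsion W p)) ∧
      (∀ (q : ℕ) [Fact q.Prime], W.HasGoodReductionAtPrime q →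
        ∀ v : HeightOneSpectrum (𝓞 ℚ), (Rat.HeightOneSpectrum.primesEquiv v : ℕ) = q →
        ∀ 𝔔 ∈ v.primesAbove,
          𝔔.inertia (absoluteGaloisGroup ℚ) ≤
            ((splitCartan P).comap Φ.toMonoidHom).comap (galoisRepTorsion W p)) :=
  Literature.NumberTheory.EllipticCurves.Rank1Residual.ClassX9.exists_index_two_subgroup_split W p Φ
    e he (classX9_census_of_classX9 W p h) h7

/-! ### `stub_primes` modulo the published split-Cartan classification -/

/-- **`stub_primes` of crux `AnalyticMuZeroX9`, discharged MODULO Bilu–Parent–Rebolledo 2013 +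
Balakrishnan–Dogra–Müller–Tuitman–Vonk 2019: X9 lives at `p ∈ {5, 7}`.**  The conclusion is the
registered stub signature verbatim (`∀ W p, Rank1Residual.ClassX9 W p → p = 5 ∨ p = 7`, skeleton
af91c27a of stmt-BirchSwinnertonDyer-19630); the one binder `hBDMTV` is the vendored named fact
`BalakrishnanEtAl2019.thm12_not_le_normalizer_splitCartan` (Ann. of Math. 189 (2019) Thm. 1.2
"only if": no non-CM `E/ℚ` has mod-`p` image in the normaliser of a split Cartan subgroup for
`p > 7`; PUBLISHED, no `_holds`).  Proof: this lineage's `Rank1Residual.ClassX9.eq_five_or_eq_seven`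
(for `p ≥ 11` the image at a good ordinary irreducible non-surjective prime normalises a split
Cartan subgroup — Serre, kernel — which the fact forbids for a non-CM curve) along the bridge
`classX9_census_of_classX9`.  CONDITIONAL on `hBDMTV` and on nothing else.
[cite: BalakrishnanEtAl2019, §1 Thm. 1.2 (arXiv:1711.05846 p. 2)]
[cite: BiluParentRebolledo2013, Cor. 1.2 (arXiv:1104.4641 p. 4)] -/
theorem ClassX9.eq_five_or_eq_seven_of_thm12
    (hBDMTV : BalakrishnanEtAl2019.thm12_not_le_normalizer_splitCartan) :
    ∀ (W : WeierstrassCurve ℚ) [W.IsElliptic] [W.IsGloballyMinimal] (p : ℕ) [Fact p.Prime],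
      ClassX9 W p → p = 5 ∨ p = 7 :=
  fun W _ _ p _ h ↦
    Literature.NumberTheory.EllipticCurves.Rank1Residual.ClassX9.eq_five_or_eq_seven hBDMTV W p
      (classX9_census_of_classX9 W p h)

/-! ### The crux from its two per-prime statements (modulo the same fact) -/

/-- **Crux `AnalyticMuZeroX9` ⟸ `stub_five` ∧ `stub_seven`, modulo the split-Cartan classification
(KERNEL composition).**  With `hBDMTV` as above, Greenberg's analytic `μ = 0` on class X9 — the
item's signature `Rank1Residual.AnalyticMuZeroOnClassX9` (stmt-BirchSwinnertonDyer-19630; the route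
decl `Theses.SmallImageMuTransfer.AnalyticMuZeroX9` is `def … := AnalyticMuZeroOnClassX9`): every X9
pair and every newform of the curve has a `p`-adic unit among the coefficients of `L_p(f, α)` —
follows from the same statement at `p = 5` (`h5`, verbatim the registered `stub_five`) and at
`p = 7` (`h7`, verbatim the registered `stub_seven`).  This is the composition `AnalyticMuZeroX9_of`
of the item's skeleton with the fact binder made explicit (the shape `skeleton check` does not
register, `skeleton.extra-hypothesis`; legal as a theorem).  `h5`, `h7` stay hypotheses — OPEN as
class statements, certified per pair by the lane; nothing is asserted about them here.
[cite: BalakrishnanEtAl2019, §1 Thm. 1.2 (arXiv:1711.05846 p. 2)]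
[cite: GreenbergLNM1716, §1 Conj. 1.11] -/
theorem analyticMuZeroX9_of_thm12
    (hBDMTV : BalakrishnanEtAl2019.thm12_not_le_normalizer_splitCartan)
    (h5 : ∀ (W : WeierstrassCurve ℚ) [W.IsElliptic] [W.IsGloballyMinimal] [Fact (Nat.Prime 5)]
      {N : ℕ} [NeZero N] (f : CuspForm (Gamma0 N) 2),
      ClassX9 W 5 → IsNewformOf W f →
        ∃ n : ℕ, ‖PowerSeries.coeff n (padicLFunction f (unitRoot W 5 : ℚ_[5]))‖ = 1)
    (h7 : ∀ (W : WeierstrassCurve ℚ) [W.IsElliptic] [W.IsGloballyMinimal] [Fact (Nat.Prime 7)]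
      {N : ℕ} [NeZero N] (f : CuspForm (Gamma0 N) 2),
      ClassX9 W 7 → IsNewformOf W f →
        ∃ n : ℕ, ‖PowerSeries.coeff n (padicLFunction f (unitRoot W 7 : ℚ_[7]))‖ = 1) :
    AnalyticMuZeroOnClassX9 := by
  intro W _ _ p _ N _ f hX9 hf
  rcases ClassX9.eq_five_or_eq_seven_of_thm12 hBDMTV W p hX9 with rfl | rfl
  · exact h5 W f hX9 hf
  · exact h7 W f hX9 hf

end Summit.BirchSwinnertonDyer.BirchSwinnertonDyer.Rank1Residual

end
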